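import Literature.Topology.FourManifolds.CyclicCoverSheets
import Literature.AlgebraicTopology.SingularHomology.MayerVietorisExactness
import Literature.AlgebraicTopology.SingularHomology.CapProduct
import HarnessLib

/-!
# Mayer–Vietoris for the infinite cyclic cover cut open along a level set

Topic `Literature/Topology/FourManifolds`; third module of the covering-space road to the Seifert
presentation of the Alexander module (after `InfiniteCyclicCover.lean`, `AlexanderModuleCover.lean`,
`CyclicCoverSheets.lean`; algebraic half in `AlexanderModuleHNN.lean`, `SliceKnotsFoxMilnor*.lean`).
This is the homological heart of D. Rolfsen, *Knots and Links* (1976), §8.C (proof that a Seifert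
matrix `V` presents `H₁(X̃)` by `tV − Vᵀ`; = W. B. R. Lickorish, *An Introduction to Knot Theory*
(1997), Thm. 6.5), in the following abstract form.

Let `f : X → S¹`, `X̃ = CircleMaps.CyclicCover f` its infinite cyclic cover, and let `X = Y ∪ N`
with `Y`, `N` open, `f ≠ 1` on `Y` (so `Y` misses the cut `F = f⁻¹(1)`) and `f ≠ -1` on `N` (a thin
neighbourhood of `F`): a `CutData f`. Then `Y ∩ N = N₊ ⊔ N₋` according to the side of the cut
(`0 < level < π` / `π < level < 2π`), `X̃ = proj⁻¹ Y ∪ proj⁻¹ N` is an open cover whose pieces and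
intersection are disjoint unions of copies of `Y`, `N`, `Y ∩ N` (`CyclicCoverSheets.lean`), and the
Mayer–Vietoris sequence (tree: `mayerVietoris.φ/ψ/δ`, `exact₁₂₃_holds`) yields, writing
`genₖ : H₁(Y) → H₁(X̃)` for the `k`-th copy (`liftY`), `i± : H₁(N±) → H₁(Y)`, `j± : H₁(N±) → H₁(N)`
for the maps induced by the inclusions:

* `CutData.exists_eq_sum_gen` — if `N₊`, `N₋` are path connected (or empty) and
  `j₊ : H₁(N₊) → H₁(N)` is onto, **the classes `genₖ a` generate `H₁(X̃)`**;
* `CutData.gen_rel` — **the relations** `genₖ (i₋ b) = genₖ₊₁ (i₊ b')` whenever `j₋ b = j₊ b'`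
  (the cycle `j₋ b = j₊ b'` of `N`, pushed to the two sides of the cut, lands in consecutive copies
  of `Y`);
* `CutData.exists_rel_of_sum_gen_eq_zero` — **these are all the relations**: every vanishing
  finite sum `∑ₖ genₖ aₖ = 0` has `aₖ = i₋ bₖ − i₊ b'ₖ₋₁` with `j₋ bₖ = j₊ b'ₖ` for finitely
  supported families `b`, `b'` (unconditionally);
* `CutData.deck_gen` — the deck transformation by `m` carries `genₖ` to `genₖ₊ₘ`.

With a bicollar `N ≅ F × (-1, 1)` of a two-sided `F` (so `N± ≃ N ≃ F` and `j±` are isomorphisms)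
this says: `H₁(X̃) ≅ (⊕ₖ tᵏ H₁(Y)) / (tᵏ⁺¹ ι₊ c = tᵏ ι₋ c, c ∈ H₁(F))`, `ι± = i± ∘ j±⁻¹` the two
push-offs — Rolfsen's presentation, prior to choosing bases (the matrices then come from Alexander
duality, not treated here). Everything is proved; no named fact is introduced.

## References

* D. Rolfsen, *Knots and Links*, Publish or Perish (1976), §8.C (and §5.C, §7.A). [Rolfsen1976]
* W. B. R. Lickorish, *An Introduction to Knot Theory*, GTM 175 (1997), Thm. 6.5. [Lickorish1997]
* A. Hatcher, *Algebraic Topology*, CUP (2002), §2.2 pp. 149–150 (Mayer–Vietoris), Prop. 2.6,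
  Prop. 2.7. [HatcherAT2002]

## Design notes

* The cut value for `Y` is `exp 0 = 1`, that for `N` is `exp (-π) = -1`; the copies of `N` are the
  windows `(2πk − π, 2πk + π)` of the level, those of `Y` the windows `(2πk, 2πk + 2π)`; on `N₊`
  the two `k`-th sections agree, on `N₋` the `k`-th section over `Y` is the `(k+1)`-st over `N`
  (`sheetSection_zero_eq_of_mem_minus`) — the source of the shift `k ↦ k + 1` in the relations.
* The surjectivity statement needs the connecting map `H₁(X̃) → H₀` to vanish, i.e. the first
  Mayer–Vietoris map to be injective on `H₀`; this is the finite-support argument on the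
  augmentations of the `H₀`-classes of the pieces (`φ_zero_injective`), which is where the path
  connectedness of `N±` enters.
-/

noncomputable section

-- as in the tree's singular-homology files (`SingularChainsConcrete.lean`, `ClopenAdditivity.lean`):
-- unification through the `ModuleCat`/biproduct API needs the permissive transparency setting
set_option backward.isDefEq.respectTransparency false

open Set Function Complex CategoryTheory Limits
open scoped Real Topology
open Literature.AlgebraicTopology.SingularHomology

universe u

namespace Literature.Topology.FourManifolds

namespace CircleMaps

namespace CyclicCover

variable {X : Type u} [TopologicalSpace X] {f : C(X, Circle)}

/-! ### Cut data -/

variable (f) in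
/-- **Cut data** for the circle-valued map `f`: an open cover `X = Y ∪ N` with `f ≠ 1` on `Y` (the
cut-open complement of the level set `F = f⁻¹(1)`) and `f ≠ -1` on `N` (a neighbourhood of `F`
thin enough to stay off the opposite level) (Rolfsen 1976, §8.C: `Y = S³ ∖ F` and a bicollar `N` of
the Seifert surface). [cite: Rolfsen1976, §8.C] -/
structure CutData where
  /-- the cut-open complement -/
  Y : Set X
  /-- the neighbourhood of the cut -/
  N : Set X
  isOpen_Y : IsOpen Y
  isOpen_N : IsOpen N
  union_eq : Y ∪ N = univ
  ne_one : ∀ x ∈ Y, f x ≠ Circle.exp 0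
  ne_neg_one : ∀ x ∈ N, f x ≠ Circle.exp (-π)

namespace CutData

variable (D : CutData f)

/-- `exp (-π) = exp π` (`= -1`). [folklore] -/
theorem exp_neg_pi : Circle.exp (-π) = Circle.exp π := by
  rw [← Circle.exp_add_two_pi (-π)]
  congr 1
  ring

/-- On `N` the branch of the level over `{f ≠ 1}` avoids `π`. [folklore] -/
theorem sheetLevel_ne_pi {x : X} (hx : x ∈ D.N) : sheetLevel f 0 x ≠ π := by
  intro h
  apply D.ne_neg_one x hx
  rw [exp_neg_pi, ← h, exp_sheetLevel]

/-- **The plus side** `N₊ = {x ∈ Y ∩ N | level < π}` of the cut inside `Y ∩ N`. [folklore] -/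
def plus : Set X := (D.Y ∩ D.N) ∩ sheetLevel f 0 ⁻¹' Iio π

/-- **The minus side** `N₋ = {x ∈ Y ∩ N | π < level}` of the cut inside `Y ∩ N`. [folklore] -/
def minus : Set X := (D.Y ∩ D.N) ∩ sheetLevel f 0 ⁻¹' Ioi π

/-- Membership in `N₊`. [folklore] -/
theorem mem_plus_iff {x : X} : x ∈ D.plus ↔ (x ∈ D.Y ∧ x ∈ D.N) ∧ sheetLevel f 0 x < π := Iff.rfl

/-- Membership in `N₋`. [folklore] -/
theorem mem_minus_iff {x : X} : x ∈ D.minus ↔ (x ∈ D.Y ∧ x ∈ D.N) ∧ π < sheetLevel f 0 x := Iff.rfl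

/-- `N₊ ⊆ Y`. [folklore] -/
theorem plus_subset_Y : D.plus ⊆ D.Y := fun _ hx => hx.1.1

/-- `N₊ ⊆ N`. [folklore] -/
theorem plus_subset_N : D.plus ⊆ D.N := fun _ hx => hx.1.2

/-- `N₋ ⊆ Y`. [folklore] -/
theorem minus_subset_Y : D.minus ⊆ D.Y := fun _ hx => hx.1.1

/-- `N₋ ⊆ N`. [folklore] -/
theorem minus_subset_N : D.minus ⊆ D.N := fun _ hx => hx.1.2

/-- `N₊ ⊆ Y ∩ N`. [folklore] -/
theorem plus_subset_inter : D.plus ⊆ D.Y ∩ D.N := fun _ hx => hx.1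

/-- `N₋ ⊆ Y ∩ N`. [folklore] -/
theorem minus_subset_inter : D.minus ⊆ D.Y ∩ D.N := fun _ hx => hx.1

/-- `Y ∩ N = N₊ ∪ N₋`. [folklore] -/
theorem plus_union_minus : D.plus ∪ D.minus = D.Y ∩ D.N := by
  ext x
  constructor
  · rintro (hx | hx)
    exacts [hx.1, hx.1]
  · intro hx
    rcases lt_or_gt_of_ne (D.sheetLevel_ne_pi hx.2) with h | h
    exacts [Or.inl ⟨hx, h⟩, Or.inr ⟨hx, h⟩]

/-- `N₊ ∩ N₋ = ∅`. [folklore] -/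
theorem disjoint_plus_minus : Disjoint D.plus D.minus :=
  Set.disjoint_left.2 fun x h₁ h₂ =>
    lt_asymm (show sheetLevel f 0 x < π from h₁.2) (show π < sheetLevel f 0 x from h₂.2)

/-- The branch of the level is continuous on `Y ∩ N`. [folklore] -/
theorem continuousOn_sheetLevel_inter : ContinuousOn (sheetLevel f 0) (D.Y ∩ D.N) :=
  (continuousOn_sheetLevel f 0).mono fun x hx => D.ne_one x hx.1

/-- `N₊` is open. [folklore] -/
theorem isOpen_plus : IsOpen D.plus :=
  D.continuousOn_sheetLevel_inter.isOpen_inter_preimage (D.isOpen_Y.inter D.isOpen_N) isOpen_Iio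

/-- `N₋` is open. [folklore] -/
theorem isOpen_minus : IsOpen D.minus :=
  D.continuousOn_sheetLevel_inter.isOpen_inter_preimage (D.isOpen_Y.inter D.isOpen_N) isOpen_Ioi

/-- `Y` misses the cut value `exp 0`. [folklore] -/
theorem hY : ∀ x ∈ D.Y, f x ≠ Circle.exp 0 := D.ne_one

/-- `N` misses the cut value `exp (-π)`. [folklore] -/
theorem hN : ∀ x ∈ D.N, f x ≠ Circle.exp (-π) := D.ne_neg_one

/-- `Y ∩ N` misses the cut value `exp 0`. [folklore] -/
theorem hYN : ∀ x ∈ D.Y ∩ D.N, f x ≠ Circle.exp 0 := fun x hx => D.ne_one x hx.1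

/-! ### The two systems of sections agree up to the shift -/

/-- **On `N₊` the `k`-th sections over `Y` and over `N` agree** (both levels lie in `(2πk, 2πk + π)`).
[folklore] -/
theorem sheetSection_neg_pi_eq_of_mem_plus (k : ℤ) {x : X} (hx : x ∈ D.plus) :
    sheetSection f (-π) k x = sheetSection f 0 k x := by
  refine CyclicCover.ext rfl ?_
  simp only [level_sheetSection, add_left_inj]
  obtain ⟨h0l, -⟩ := sheetLevel_mem_Ioo f 0 (D.ne_one x hx.1.1)
  obtain ⟨h1l, h1r⟩ := sheetLevel_mem_Ioo f (-π) (D.ne_neg_one x hx.1.2)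
  have hxπ : sheetLevel f 0 x < π := hx.2
  refine eq_of_exp_eq_of_mem_Ioo (b := -π) (by rw [exp_sheetLevel, exp_sheetLevel]) ?_ ?_
  · exact ⟨h1l, by linarith⟩
  · exact ⟨by linarith, by linarith⟩

/-- **On `N₋` the `k`-th section over `Y` is the `(k + 1)`-st over `N`** (the level over `Y` lies in
`(2πk + π, 2πk + 2π) = (2π(k+1) − π, 2π(k+1))`). [folklore] -/
theorem sheetSection_zero_eq_of_mem_minus (k : ℤ) {x : X} (hx : x ∈ D.minus) :
    sheetSection f 0 k x = sheetSection f (-π) (k + 1) x := by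
  refine CyclicCover.ext rfl ?_
  simp only [level_sheetSection]
  obtain ⟨-, h0r⟩ := sheetLevel_mem_Ioo f 0 (D.ne_one x hx.1.1)
  obtain ⟨h1l, h1r⟩ := sheetLevel_mem_Ioo f (-π) (D.ne_neg_one x hx.1.2)
  have hxπ : π < sheetLevel f 0 x := hx.2
  have key : sheetLevel f 0 x = sheetLevel f (-π) x + 2 * π := by
    refine eq_of_exp_eq_of_mem_Ioo (b := π) ?_ ?_ ?_
    · rw [Circle.exp_add_two_pi, exp_sheetLevel, exp_sheetLevel]
    · exact ⟨hxπ, by linarith⟩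
    · exact ⟨by linarith, by linarith⟩
  rw [key]
  push_cast
  ring

/-! ### The open cover of the cover -/

/-- `Ũ = proj⁻¹ Y`. [folklore] -/
def U : Set (CyclicCover f) := (proj : CyclicCover f → X) ⁻¹' D.Y

/-- `Ṽ = proj⁻¹ N`. [folklore] -/
def V : Set (CyclicCover f) := (proj : CyclicCover f → X) ⁻¹' D.N

/-- `Ũ` is open. [folklore] -/
theorem isOpen_U : IsOpen D.U := D.isOpen_Y.preimage continuous_proj

/-- `Ṽ` is open. [folklore] -/
theorem isOpen_V : IsOpen D.V := D.isOpen_N.preimage continuous_proj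

/-- `Ũ ∪ Ṽ = X̃`. [folklore] -/
theorem U_union_V : D.U ∪ D.V = univ := by
  rw [U, V, ← preimage_union, D.union_eq, preimage_univ]

/-- The interiors of `Ũ`, `Ṽ` cover (both are open). [folklore] -/
theorem interior_U_union_interior_V : interior D.U ∪ interior D.V = univ := by
  rw [D.isOpen_U.interior_eq, D.isOpen_V.interior_eq, D.U_union_V]

/-- `Ũ ∩ Ṽ = proj⁻¹ (Y ∩ N)`, definitionally. [folklore] -/
theorem U_inter_V : D.U ∩ D.V = (proj : CyclicCover f → X) ⁻¹' (D.Y ∩ D.N) := rfl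

/-! ### The copies of `Y`, `N`, `N±` inside the cover and their compatibilities -/

/-- The `k`-th copy of `Y` in `X̃`, `↥Y → X̃`. [folklore] -/
def liftY (k : ℤ) : C(↥D.Y, CyclicCover f) := (subsetIncl D.U).comp (sheetEmb D.hY k)

/-- The `k`-th copy of `N` in `X̃`, `↥N → X̃`. [folklore] -/
def liftN (k : ℤ) : C(↥D.N, CyclicCover f) := (subsetIncl D.V).comp (sheetEmb D.hN k)

/-- `liftY k y = sheetSection f 0 k y`. [folklore] -/
@[simp] theorem liftY_apply (k : ℤ) (y : D.Y) : D.liftY k y = sheetSection f 0 k y := rfl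

/-- `liftN k y = sheetSection f (-π) k y`. [folklore] -/
@[simp] theorem liftN_apply (k : ℤ) (y : D.N) : D.liftN k y = sheetSection f (-π) k y := rfl

/-- The `k`-th copy of `Y ∩ N` inside `Ũ ∩ Ṽ` followed by the inclusion into `Ũ`, restricted to
`N₊`: it is the `k`-th copy of `Y` restricted to `N₊`. [folklore] -/
theorem inclLeft_comp_sheetEmb_comp_plus (k : ℤ) :
    ((subsetInclusion (inter_subset_left : D.U ∩ D.V ⊆ D.U)).comp (sheetEmb D.hYN k)).comp
        (subsetInclusion D.plus_subset_inter) =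
      (sheetEmb D.hY k).comp (subsetInclusion D.plus_subset_Y) :=
  rfl

/-- Same on `N₋`. [folklore] -/
theorem inclLeft_comp_sheetEmb_comp_minus (k : ℤ) :
    ((subsetInclusion (inter_subset_left : D.U ∩ D.V ⊆ D.U)).comp (sheetEmb D.hYN k)).comp
        (subsetInclusion D.minus_subset_inter) =
      (sheetEmb D.hY k).comp (subsetInclusion D.minus_subset_Y) :=
  rfl

/-- The `k`-th copy of `Y ∩ N` followed by the inclusion into `Ṽ`, restricted to `N₊`: it is the
`k`-th copy of `N` restricted to `N₊` (the sections agree on `N₊`). [folklore] -/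
theorem inclRight_comp_sheetEmb_comp_plus (k : ℤ) :
    ((subsetInclusion (inter_subset_right : D.U ∩ D.V ⊆ D.V)).comp (sheetEmb D.hYN k)).comp
        (subsetInclusion D.plus_subset_inter) =
      (sheetEmb D.hN k).comp (subsetInclusion D.plus_subset_N) := by
  ext x : 2
  exact (D.sheetSection_neg_pi_eq_of_mem_plus k x.2).symm

/-- On `N₋` the `k`-th copy of `Y ∩ N`, included into `Ṽ`, is the `(k + 1)`-st copy of `N`
restricted to `N₋`. [folklore] -/
theorem inclRight_comp_sheetEmb_comp_minus (k : ℤ) :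
    ((subsetInclusion (inter_subset_right : D.U ∩ D.V ⊆ D.V)).comp (sheetEmb D.hYN k)).comp
        (subsetInclusion D.minus_subset_inter) =
      (sheetEmb D.hN (k + 1)).comp (subsetInclusion D.minus_subset_N) := by
  ext x : 2
  exact D.sheetSection_zero_eq_of_mem_minus k x.2

/-! ### The maps induced by the inclusions and by the copies -/

section Homology

variable (R : Type) [CommRing R] (M : Type) [AddCommGroup M] [Module R M]


/-- `i₊ : Hₙ(N₊) → Hₙ(Y)`. [folklore] -/
abbrev iPlus (n : ℕ) := singularHomology.map R M (subsetInclusion D.plus_subset_Y) n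
/-- `i₋ : Hₙ(N₋) → Hₙ(Y)`. [folklore] -/
abbrev iMinus (n : ℕ) := singularHomology.map R M (subsetInclusion D.minus_subset_Y) n
/-- `j₊ : Hₙ(N₊) → Hₙ(N)`. [folklore] -/
abbrev jPlus (n : ℕ) := singularHomology.map R M (subsetInclusion D.plus_subset_N) n
/-- `j₋ : Hₙ(N₋) → Hₙ(N)`. [folklore] -/
abbrev jMinus (n : ℕ) := singularHomology.map R M (subsetInclusion D.minus_subset_N) n
/-- **`genₖ : Hₙ(Y) → Hₙ(X̃)`**, the `k`-th copy of `Y` (Rolfsen 1976, §8.C: `H₁(Yₖ) → H₁(X̃)`).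
[cite: Rolfsen1976, §8.C] -/
abbrev gen (k : ℤ) (n : ℕ) := singularHomology.map R M (D.liftY k) n
/-- `genNₖ : Hₙ(N) → Hₙ(X̃)`, the `k`-th copy of `N`. [folklore] -/
abbrev genN (k : ℤ) (n : ℕ) := singularHomology.map R M (D.liftN k) n

/-- `genₖ a = (incl Ũ)_* (Eₖ a)` with `Eₖ` the `k`-th copy of `Y` in `Ũ`. [folklore] -/
theorem gen_apply (k : ℤ) (n : ℕ) (a : singularHomology R M ↥D.Y n) :
    D.gen R M k n a =
      singularHomology.map R M (subsetIncl D.U) n (singularHomology.map R M (sheetEmb D.hY k) n a) := by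
  change singularHomology.map R M ((subsetIncl D.U).comp (sheetEmb D.hY k)) n a = _
  rw [singularHomology.map_comp]
  rfl

/-- `genNₖ c = (incl Ṽ)_* (Eₖ c)` with `Eₖ` the `k`-th copy of `N` in `Ṽ`. [folklore] -/
theorem genN_apply (k : ℤ) (n : ℕ) (c : singularHomology R M ↥D.N n) :
    D.genN R M k n c =
      singularHomology.map R M (subsetIncl D.V) n (singularHomology.map R M (sheetEmb D.hN k) n c) := by
  change singularHomology.map R M ((subsetIncl D.V).comp (sheetEmb D.hN k)) n c = _
  rw [singularHomology.map_comp]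
  rfl

/-! ### Relations and the deck action -/

/-- On `N₊` the `k`-th copies of `Y` and of `N` agree, as maps `↥N₊ → X̃`. [folklore] -/
theorem liftY_comp_plus (k : ℤ) :
    (D.liftY k).comp (subsetInclusion D.plus_subset_Y) = (D.liftN k).comp (subsetInclusion D.plus_subset_N) := by
  ext x : 1
  exact (D.sheetSection_neg_pi_eq_of_mem_plus k x.2).symm

/-- On `N₋` the `k`-th copy of `Y` is the `(k + 1)`-st copy of `N`, as maps `↥N₋ → X̃`. [folklore] -/
theorem liftY_comp_minus (k : ℤ) :
    (D.liftY k).comp (subsetInclusion D.minus_subset_Y) =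
      (D.liftN (k + 1)).comp (subsetInclusion D.minus_subset_N) := by
  ext x : 1
  exact D.sheetSection_zero_eq_of_mem_minus k x.2

/-- `genₖ ∘ i₊ = genNₖ ∘ j₊`. [folklore] -/
theorem gen_iPlus (k : ℤ) (n : ℕ) (b : singularHomology R M ↥D.plus n) :
    D.gen R M k n (D.iPlus R M n b) = D.genN R M k n (D.jPlus R M n b) := by
  rw [← ModuleCat.comp_apply, ← ModuleCat.comp_apply, ← singularHomology.map_comp,
    ← singularHomology.map_comp, liftY_comp_plus]

/-- `genₖ ∘ i₋ = genNₖ₊₁ ∘ j₋`. [folklore] -/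
theorem gen_iMinus (k : ℤ) (n : ℕ) (b : singularHomology R M ↥D.minus n) :
    D.gen R M k n (D.iMinus R M n b) = D.genN R M (k + 1) n (D.jMinus R M n b) := by
  rw [← ModuleCat.comp_apply, ← ModuleCat.comp_apply, ← singularHomology.map_comp,
    ← singularHomology.map_comp, liftY_comp_minus]

/-- **The relations** (Rolfsen 1976, §8.C: a cycle of the collar pushed to the two sides of the
Seifert surface lies in consecutive copies of the cut-open complement): if `j₋ b = j₊ b'` in
`Hₙ(N)` then `genₖ (i₋ b) = genₖ₊₁ (i₊ b')` in `Hₙ(X̃)`. [cite: Rolfsen1976, §8.C] -/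
theorem gen_rel (k : ℤ) (n : ℕ) {b : singularHomology R M ↥D.minus n}
    {b' : singularHomology R M ↥D.plus n} (h : D.jMinus R M n b = D.jPlus R M n b') :
    D.gen R M k n (D.iMinus R M n b) = D.gen R M (k + 1) n (D.iPlus R M n b') := by
  rw [gen_iMinus, gen_iPlus, h]

/-- **The deck transformation by `m` carries the `k`-th copy of `Y` to the `(k + m)`-th.**
[folklore] -/
theorem deck_comp_liftY (m k : ℤ) :
    (⟨(m +ᵥ ·), continuous_const_vadd m⟩ : C(CyclicCover f, CyclicCover f)).comp (D.liftY k) =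
      D.liftY (k + m) := by
  ext y : 1
  exact vadd_sheetSection f 0 m k y

/-- `(τₘ)_* ∘ genₖ = genₖ₊ₘ` on `Hₙ` (Rolfsen 1976, §8.C: "`t` carries `Yᵢ` to `Yᵢ₊₁`").
[cite: Rolfsen1976, §8.C] -/
theorem deck_gen (m k : ℤ) (n : ℕ) (a : singularHomology R M ↥D.Y n) :
    singularHomology.map R M (⟨(m +ᵥ ·), continuous_const_vadd m⟩ : C(CyclicCover f, CyclicCover f)) n
        (D.gen R M k n a) = D.gen R M (k + m) n a := by
  rw [← ModuleCat.comp_apply, ← singularHomology.map_comp, deck_comp_liftY]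

/-! ### Independence of the copies, for families with finite support -/

variable {R M}

/-- A sum of push-forwards into the copies over a finite set containing the support of the family
does not depend on the finite set. [folklore] -/
theorem sum_map_sheetEmb_eq_of_subset {a : ℝ} {Z : Set X} (hZ : ∀ x ∈ Z, f x ≠ Circle.exp a) (n : ℕ)
    {S T : Finset ℤ} (hST : S ⊆ T) (x : ℤ → singularHomology R M ↥Z n) (hx : ∀ k ∉ S, x k = 0) :
    ∑ k ∈ S, singularHomology.map R M (sheetEmb hZ k) n (x k) =
      ∑ k ∈ T, singularHomology.map R M (sheetEmb hZ k) n (x k) :=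
  Finset.sum_subset hST fun k _ hkS => by rw [hx k hkS, map_zero]

/-- **Two finitely supported families pushed into the copies of `Z` with the same sum agree**
(independence of the copies, `eq_zero_of_sum_map_sheetEmb_eq_zero`). [folklore] -/
theorem eq_of_sum_map_sheetEmb_eq {a : ℝ} {Z : Set X} (hZ : ∀ x ∈ Z, f x ≠ Circle.exp a) (n : ℕ)
    (S : Finset ℤ) (x y : ℤ → singularHomology R M ↥Z n) (hx : ∀ k ∉ S, x k = 0)
    (hy : ∀ k ∉ S, y k = 0)
    (h : ∑ k ∈ S, singularHomology.map R M (sheetEmb hZ k) n (x k) =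
      ∑ k ∈ S, singularHomology.map R M (sheetEmb hZ k) n (y k)) (k : ℤ) : x k = y k := by
  by_cases hk : k ∈ S
  · have hsum : ∑ j ∈ S, singularHomology.map R M (sheetEmb hZ j) n (x j - y j) = 0 := by
      simp only [map_sub, Finset.sum_sub_distrib, h, sub_self]
    exact sub_eq_zero.1 (eq_zero_of_sum_map_sheetEmb_eq_zero hZ R M n S (fun j => x j - y j) hsum k hk)
  · rw [hx k hk, hy k hk]

/-! ### Classes of `Y ∩ N` split along `N₊ ⊔ N₋` -/

/-- The two pieces `N₊`, `N₋` of `Y ∩ N`, as subsets of the subspace `↥(Y ∩ N)` indexed by `Bool`.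
[folklore] -/
def bpiece : Bool → Set ↥(D.Y ∩ D.N)
  | true => Subtype.val ⁻¹' D.plus
  | false => Subtype.val ⁻¹' D.minus

/-- The two-piece clopen partition of `↥(Y ∩ N)` by `N₊` and `N₋`. [folklore] -/
theorem isClopenPartition_bpiece : IsClopenPartition D.bpiece where
  isOpen b := by
    cases b
    · exact D.isOpen_minus.preimage continuous_subtype_val
    · exact D.isOpen_plus.preimage continuous_subtype_val
  disjoint b c hbc := by
    cases b <;> cases c
    · exact (hbc rfl).elim
    · exact (D.disjoint_plus_minus.preimage Subtype.val).symm
    · exact D.disjoint_plus_minus.preimage Subtype.val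
    · exact (hbc rfl).elim
  exists_mem z := by
    have hz : (z : X) ∈ D.plus ∪ D.minus := by rw [plus_union_minus]; exact z.2
    rcases hz with hz | hz
    · exact ⟨true, hz⟩
    · exact ⟨false, hz⟩

/-- `↥(val ⁻¹' N₊ : Set ↥(Y ∩ N)) ≃ₜ ↥N₊`. [folklore] -/
def plusHomeomorph : ↥(Subtype.val ⁻¹' D.plus : Set ↥(D.Y ∩ D.N)) ≃ₜ ↥D.plus :=
  (preimageValHomeomorph (D.Y ∩ D.N) D.plus).trans
    (Homeomorph.setCongr (inter_eq_right.2 D.plus_subset_inter))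

/-- `↥(val ⁻¹' N₋ : Set ↥(Y ∩ N)) ≃ₜ ↥N₋`. [folklore] -/
def minusHomeomorph : ↥(Subtype.val ⁻¹' D.minus : Set ↥(D.Y ∩ D.N)) ≃ₜ ↥D.minus :=
  (preimageValHomeomorph (D.Y ∩ D.N) D.minus).trans
    (Homeomorph.setCongr (inter_eq_right.2 D.minus_subset_inter))

/-- The inclusion `N₊ ↪ Y ∩ N` through the homeomorphism. [folklore] -/
theorem subsetIncl_comp_plusHomeomorph_symm :
    (subsetIncl (Subtype.val ⁻¹' D.plus : Set ↥(D.Y ∩ D.N))).comp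
        (D.plusHomeomorph.symm : C(↥D.plus, ↥(Subtype.val ⁻¹' D.plus : Set ↥(D.Y ∩ D.N)))) =
      subsetInclusion D.plus_subset_inter := by
  ext x : 2
  rfl

/-- The inclusion `N₋ ↪ Y ∩ N` through the homeomorphism. [folklore] -/
theorem subsetIncl_comp_minusHomeomorph_symm :
    (subsetIncl (Subtype.val ⁻¹' D.minus : Set ↥(D.Y ∩ D.N))).comp
        (D.minusHomeomorph.symm : C(↥D.minus, ↥(Subtype.val ⁻¹' D.minus : Set ↥(D.Y ∩ D.N)))) =
      subsetInclusion D.minus_subset_inter := by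
  ext x : 2
  rfl

variable (R M) in
/-- **Every class of `Hₙ(Y ∩ N)` is `incl₊_* p + incl₋_* q`** (additivity over `Y ∩ N = N₊ ⊔ N₋`,
Hatcher Prop. 2.6). [cite: HatcherAT2002, Prop. 2.6] -/
theorem exists_eq_plus_add_minus (n : ℕ) (e : singularHomology R M ↥(D.Y ∩ D.N) n) :
    ∃ (p : singularHomology R M ↥D.plus n) (q : singularHomology R M ↥D.minus n),
      e = singularHomology.map R M (subsetInclusion D.plus_subset_inter) n p +
        singularHomology.map R M (subsetInclusion D.minus_subset_inter) n q := by
  classical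
  obtain ⟨S, x, rfl⟩ := singularHomology.exists_eq_sum_map_subsetIncl (R := R) (M := M)
    D.isClopenPartition_bpiece n e
  -- extend the family by zero to all of `Bool`
  have hsum : ∑ b ∈ S, singularHomology.map R M (subsetIncl (D.bpiece b)) n (x b) =
      ∑ b, singularHomology.map R M (subsetIncl (D.bpiece b)) n (if b ∈ S then x b else 0) := by
    rw [← Finset.sum_subset (Finset.subset_univ S)]
    · exact Finset.sum_congr rfl fun b hb => by rw [if_pos hb]
    · intro b _ hb
      rw [if_neg hb, map_zero]
  rw [hsum, Fintype.sum_bool]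
  -- the two values, read in `N₊`, `N₋` through the homeomorphisms
  set xt : singularHomology R M ↥(Subtype.val ⁻¹' D.plus : Set ↥(D.Y ∩ D.N)) n :=
    if true ∈ S then x true else 0 with hxt
  set xf : singularHomology R M ↥(Subtype.val ⁻¹' D.minus : Set ↥(D.Y ∩ D.N)) n :=
    if false ∈ S then x false else 0 with hxf
  refine ⟨singularHomology.map R M (D.plusHomeomorph : C(_, ↥D.plus)) n xt,
    singularHomology.map R M (D.minusHomeomorph : C(_, ↥D.minus)) n xf, ?_⟩
  rw [← subsetIncl_comp_plusHomeomorph_symm, ← subsetIncl_comp_minusHomeomorph_symm,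
    singularHomology.map_comp, singularHomology.map_comp, ModuleCat.comp_apply, ModuleCat.comp_apply,
    map_homeomorph_symm_map, map_homeomorph_symm_map]
  rfl

/-! ### The Mayer–Vietoris maps on the copies -/

/-- First component of `φ` after the `k`-th copy of `Y ∩ N` restricted to `N₊`, as morphisms:
the `k`-th copy of `Y` after `i₊`. [folklore] -/
theorem fst_φ_plus_hom (n : ℕ) (k : ℤ) :
    singularHomology.map R M (subsetInclusion D.plus_subset_inter) n ≫
        singularHomology.map R M (sheetEmb D.hYN k) n ≫ mayerVietoris.φ R M D.U D.V n ≫ biprod.fst =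
      D.iPlus R M n ≫ singularHomology.map R M (sheetEmb D.hY k) n := by
  rw [mayerVietoris.φ, biprod.lift_fst, ← singularHomology.map_comp, ← singularHomology.map_comp,
    ← singularHomology.map_comp]
  rfl

/-- The same on `N₋`. [folklore] -/
theorem fst_φ_minus_hom (n : ℕ) (k : ℤ) :
    singularHomology.map R M (subsetInclusion D.minus_subset_inter) n ≫
        singularHomology.map R M (sheetEmb D.hYN k) n ≫ mayerVietoris.φ R M D.U D.V n ≫ biprod.fst =
      D.iMinus R M n ≫ singularHomology.map R M (sheetEmb D.hY k) n := by
  rw [mayerVietoris.φ, biprod.lift_fst, ← singularHomology.map_comp, ← singularHomology.map_comp,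
    ← singularHomology.map_comp]
  rfl

/-- Second component of `φ` after the `k`-th copy of `Y ∩ N` restricted to `N₊`, as morphisms:
minus the `k`-th copy of `N` after `j₊`. [folklore] -/
theorem snd_φ_plus_hom (n : ℕ) (k : ℤ) :
    singularHomology.map R M (subsetInclusion D.plus_subset_inter) n ≫
        singularHomology.map R M (sheetEmb D.hYN k) n ≫ mayerVietoris.φ R M D.U D.V n ≫ biprod.snd =
      -(D.jPlus R M n ≫ singularHomology.map R M (sheetEmb D.hN k) n) := by
  rw [mayerVietoris.φ, biprod.lift_snd, Preadditive.comp_neg, Preadditive.comp_neg,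
    ← singularHomology.map_comp, ← singularHomology.map_comp, ← singularHomology.map_comp,
    inclRight_comp_sheetEmb_comp_plus]

/-- The same on `N₋`, landing in the `(k + 1)`-st copy of `N`. [folklore] -/
theorem snd_φ_minus_hom (n : ℕ) (k : ℤ) :
    singularHomology.map R M (subsetInclusion D.minus_subset_inter) n ≫
        singularHomology.map R M (sheetEmb D.hYN k) n ≫ mayerVietoris.φ R M D.U D.V n ≫ biprod.snd =
      -(D.jMinus R M n ≫ singularHomology.map R M (sheetEmb D.hN (k + 1)) n) := by
  rw [mayerVietoris.φ, biprod.lift_snd, Preadditive.comp_neg, Preadditive.comp_neg,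
    ← singularHomology.map_comp, ← singularHomology.map_comp, ← singularHomology.map_comp,
    inclRight_comp_sheetEmb_comp_minus]

/-- First component of `φ` on a class pushed from `N₊` through the `k`-th copy of `Y ∩ N`.
[folklore] -/
theorem fst_φ_sheetEmb_plus (n : ℕ) (k : ℤ) (p : singularHomology R M ↥D.plus n) :
    (biprod.fst : singularHomology R M ↥D.U n ⊞ singularHomology R M ↥D.V n ⟶ singularHomology R M ↥D.U n)
        (mayerVietoris.φ R M D.U D.V n
          (singularHomology.map R M (sheetEmb D.hYN k) n
            (singularHomology.map R M (subsetInclusion D.plus_subset_inter) n p))) =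
      singularHomology.map R M (sheetEmb D.hY k) n (D.iPlus R M n p) := by
  have h := ConcreteCategory.congr_hom (D.fst_φ_plus_hom (R := R) (M := M) n k) p
  simp only [ModuleCat.comp_apply] at h
  exact h

/-- First component of `φ` on a class pushed from `N₋`. [folklore] -/
theorem fst_φ_sheetEmb_minus (n : ℕ) (k : ℤ) (q : singularHomology R M ↥D.minus n) :
    (biprod.fst : singularHomology R M ↥D.U n ⊞ singularHomology R M ↥D.V n ⟶ singularHomology R M ↥D.U n)
        (mayerVietoris.φ R M D.U D.V n
          (singularHomology.map R M (sheetEmb D.hYN k) n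
            (singularHomology.map R M (subsetInclusion D.minus_subset_inter) n q))) =
      singularHomology.map R M (sheetEmb D.hY k) n (D.iMinus R M n q) := by
  have h := ConcreteCategory.congr_hom (D.fst_φ_minus_hom (R := R) (M := M) n k) q
  simp only [ModuleCat.comp_apply] at h
  exact h

/-- Second component of `φ` on a class pushed from `N₊`: minus the `k`-th copy of `N` of `j₊`.
[folklore] -/
theorem snd_φ_sheetEmb_plus (n : ℕ) (k : ℤ) (p : singularHomology R M ↥D.plus n) :
    (biprod.snd : singularHomology R M ↥D.U n ⊞ singularHomology R M ↥D.V n ⟶ singularHomology R M ↥D.V n)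
        (mayerVietoris.φ R M D.U D.V n
          (singularHomology.map R M (sheetEmb D.hYN k) n
            (singularHomology.map R M (subsetInclusion D.plus_subset_inter) n p))) =
      -singularHomology.map R M (sheetEmb D.hN k) n (D.jPlus R M n p) := by
  have h := ConcreteCategory.congr_hom (D.snd_φ_plus_hom (R := R) (M := M) n k) p
  simp only [ModuleCat.comp_apply] at h
  exact h.trans rfl

/-- Second component of `φ` on a class pushed from `N₋`: minus the `(k + 1)`-st copy of `N` of
`j₋`. [folklore] -/
theorem snd_φ_sheetEmb_minus (n : ℕ) (k : ℤ) (q : singularHomology R M ↥D.minus n) :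
    (biprod.snd : singularHomology R M ↥D.U n ⊞ singularHomology R M ↥D.V n ⟶ singularHomology R M ↥D.V n)
        (mayerVietoris.φ R M D.U D.V n
          (singularHomology.map R M (sheetEmb D.hYN k) n
            (singularHomology.map R M (subsetInclusion D.minus_subset_inter) n q))) =
      -singularHomology.map R M (sheetEmb D.hN (k + 1)) n (D.jMinus R M n q) := by
  have h := ConcreteCategory.congr_hom (D.snd_φ_minus_hom (R := R) (M := M) n k) q
  simp only [ModuleCat.comp_apply] at h
  exact h.trans rfl

variable (R M) in
/-- **Decomposition of the classes of `Ũ ∩ Ṽ`**: every class is `∑ₖ Eₖ (incl₊ pₖ + incl₋ qₖ)` for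
families `p`, `q` in `Hₙ(N₊)`, `Hₙ(N₋)` vanishing off a finite set (`Eₖ` the `k`-th copy of `Y ∩ N`).
[folklore] -/
theorem exists_eq_sum_plus_minus (n : ℕ) (w : singularHomology R M ↥(D.U ∩ D.V) n) :
    ∃ (T : Finset ℤ) (p : ℤ → singularHomology R M ↥D.plus n) (q : ℤ → singularHomology R M ↥D.minus n),
      (∀ k ∉ T, p k = 0) ∧ (∀ k ∉ T, q k = 0) ∧
      w = ∑ k ∈ T, singularHomology.map R M (sheetEmb D.hYN k) n
        (singularHomology.map R M (subsetInclusion D.plus_subset_inter) n (p k) +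
          singularHomology.map R M (subsetInclusion D.minus_subset_inter) n (q k)) := by
  classical
  obtain ⟨T, e, he⟩ := exists_eq_sum_map_sheetEmb D.hYN R M n w
  choose p q hpq using fun k => D.exists_eq_plus_add_minus R M n (e k)
  refine ⟨T, fun k => if k ∈ T then p k else 0, fun k => if k ∈ T then q k else 0,
    fun k hk => if_neg hk, fun k hk => if_neg hk, ?_⟩
  rw [he]
  refine Finset.sum_congr rfl fun k hk => ?_
  simp only [if_pos hk]
  rw [hpq k]

/-- First component of `φ` of a decomposed class of `Ũ ∩ Ṽ`. [folklore] -/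
theorem fst_φ_sum (n : ℕ) (T : Finset ℤ) (p : ℤ → singularHomology R M ↥D.plus n)
    (q : ℤ → singularHomology R M ↥D.minus n) :
    (biprod.fst : singularHomology R M ↥D.U n ⊞ singularHomology R M ↥D.V n ⟶ singularHomology R M ↥D.U n)
        (mayerVietoris.φ R M D.U D.V n (∑ k ∈ T, singularHomology.map R M (sheetEmb D.hYN k) n
          (singularHomology.map R M (subsetInclusion D.plus_subset_inter) n (p k) +
            singularHomology.map R M (subsetInclusion D.minus_subset_inter) n (q k)))) =
      ∑ k ∈ T, singularHomology.map R M (sheetEmb D.hY k) n (D.iPlus R M n (p k) + D.iMinus R M n (q k)) := by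
  simp only [map_sum, map_add, fst_φ_sheetEmb_plus, fst_φ_sheetEmb_minus]

/-- Second component of `φ` of a decomposed class of `Ũ ∩ Ṽ`, the `N₋`-terms reindexed to the copy
in which they land. [folklore] -/
theorem snd_φ_sum (n : ℕ) (T : Finset ℤ) (p : ℤ → singularHomology R M ↥D.plus n)
    (q : ℤ → singularHomology R M ↥D.minus n) :
    (biprod.snd : singularHomology R M ↥D.U n ⊞ singularHomology R M ↥D.V n ⟶ singularHomology R M ↥D.V n)
        (mayerVietoris.φ R M D.U D.V n (∑ k ∈ T, singularHomology.map R M (sheetEmb D.hYN k) n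
          (singularHomology.map R M (subsetInclusion D.plus_subset_inter) n (p k) +
            singularHomology.map R M (subsetInclusion D.minus_subset_inter) n (q k)))) =
      -(∑ k ∈ T, singularHomology.map R M (sheetEmb D.hN k) n (D.jPlus R M n (p k)) +
        ∑ k ∈ T.map (addRightEmbedding 1),
          singularHomology.map R M (sheetEmb D.hN k) n (D.jMinus R M n (q (k - 1)))) := by
  simp only [map_sum, map_add, snd_φ_sheetEmb_plus, snd_φ_sheetEmb_minus, Finset.sum_add_distrib,
    Finset.sum_neg_distrib, neg_add, Finset.sum_map, addRightEmbedding_apply, add_sub_cancel_right]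

/-! ### Reading off the two components -/

/-- **The `Y`-component**: if `∑ₖ Eₖ (i₊ pₖ + i₋ qₖ) = ∑ₖ Eₖ aₖ` in `Hₙ(Ũ)` for finitely supported
families, then `i₊ pₖ + i₋ qₖ = aₖ` for all `k` (independence of the copies of `Y`). [folklore] -/
theorem eq_of_sum_Y_eq {n : ℕ} {T S : Finset ℤ} {p : ℤ → singularHomology R M ↥D.plus n}
    {q : ℤ → singularHomology R M ↥D.minus n} {a : ℤ → singularHomology R M ↥D.Y n}
    (hp : ∀ k ∉ T, p k = 0) (hq : ∀ k ∉ T, q k = 0) (ha : ∀ k ∉ S, a k = 0)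
    (h : ∑ k ∈ T, singularHomology.map R M (sheetEmb D.hY k) n (D.iPlus R M n (p k) + D.iMinus R M n (q k)) =
      ∑ k ∈ S, singularHomology.map R M (sheetEmb D.hY k) n (a k)) (k : ℤ) :
    D.iPlus R M n (p k) + D.iMinus R M n (q k) = a k := by
  have hx : ∀ k ∉ T, D.iPlus R M n (p k) + D.iMinus R M n (q k) = 0 := fun k hk => by
    rw [hp k hk, hq k hk, map_zero, map_zero, add_zero]
  rw [sum_map_sheetEmb_eq_of_subset D.hY n Finset.subset_union_left _ hx,
    sum_map_sheetEmb_eq_of_subset D.hY n Finset.subset_union_right _ ha] at h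
  exact eq_of_sum_map_sheetEmb_eq D.hY n (T ∪ S) _ _
    (fun k hk => hx k fun h' => hk (Finset.mem_union_left _ h'))
    (fun k hk => ha k fun h' => hk (Finset.mem_union_right _ h')) h k

/-- **The `N`-component**: if `∑ₖ Eₖ (j₊ pₖ) + ∑ₖ Eₖ₊₁ (j₋ qₖ) = 0` in `Hₙ(Ṽ)` (the second sum
reindexed) for finitely supported families, then `j₊ pₖ + j₋ qₖ₋₁ = 0` for all `k` (independence of
the copies of `N`). [folklore] -/
theorem eq_zero_of_sum_N_eq_zero {n : ℕ} {T : Finset ℤ} {p : ℤ → singularHomology R M ↥D.plus n}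
    {q : ℤ → singularHomology R M ↥D.minus n} (hp : ∀ k ∉ T, p k = 0) (hq : ∀ k ∉ T, q k = 0)
    (h : ∑ k ∈ T, singularHomology.map R M (sheetEmb D.hN k) n (D.jPlus R M n (p k)) +
        ∑ k ∈ T.map (addRightEmbedding 1),
          singularHomology.map R M (sheetEmb D.hN k) n (D.jMinus R M n (q (k - 1))) = 0) (k : ℤ) :
    D.jPlus R M n (p k) + D.jMinus R M n (q (k - 1)) = 0 := by
  have h₁ : ∀ k ∉ T, D.jPlus R M n (p k) = 0 := fun k hk => by rw [hp k hk, map_zero]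
  have h₂ : ∀ k ∉ T.map (addRightEmbedding 1), D.jMinus R M n (q (k - 1)) = 0 := fun k hk => by
    rw [hq (k - 1) fun h' => hk (Finset.mem_map.2 ⟨k - 1, h', by simp⟩), map_zero]
  rw [sum_map_sheetEmb_eq_of_subset D.hN n Finset.subset_union_left _ h₁,
    sum_map_sheetEmb_eq_of_subset D.hN n Finset.subset_union_right _ h₂, ← Finset.sum_add_distrib] at h
  simp only [← map_add] at h
  have h0 : ∑ k ∈ T ∪ T.map (addRightEmbedding 1),
      singularHomology.map R M (sheetEmb D.hN k) n (0 : singularHomology R M ↥D.N n) = 0 := by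
    simp only [map_zero, Finset.sum_const_zero]
  rw [← h0] at h
  exact eq_of_sum_map_sheetEmb_eq D.hN n _ _ (fun _ => 0)
    (fun k hk => by
      rw [h₁ k fun h' => hk (Finset.mem_union_left _ h'),
        h₂ k fun h' => hk (Finset.mem_union_right _ h'), add_zero])
    (fun _ _ => rfl) h k

/-! ### Injectivity of the first Mayer–Vietoris map in degree `0` -/

/-- The augmentation of a class does not change under push-forward. [folklore] -/
theorem ε_map {P Q : Type u} [TopologicalSpace P] [TopologicalSpace Q] (g : C(P, Q))
    (c : singularHomology R M P 0) :
    singularHomology.ε R M Q (singularHomology.map R M g 0 c) = singularHomology.ε R M P c := by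
  rw [← ModuleCat.comp_apply, singularHomology.map_ε]

/-- A family `Q : ℤ → A` with `Q k = Q (k - 1)` for all `k` and vanishing somewhere vanishes
everywhere. [folklore] -/
theorem eq_zero_of_forall_eq_pred {A : Type*} [AddGroup A] {Q : ℤ → A} (hQ : ∀ k, Q k = Q (k - 1))
    {k₁ : ℤ} (hk₁ : Q k₁ = 0) (k : ℤ) : Q k = 0 := by
  have hconst : ∀ k, Q k = Q 0 := by
    intro k
    induction k using Int.induction_on with
    | zero => rfl
    | succ j ih => rw [hQ, add_sub_cancel_right, ih]
    | pred j ih => rw [← ih, hQ (-(j : ℤ))]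
  rw [hconst k, ← hconst k₁, hk₁]

variable (R M) in
/-- **The first Mayer–Vietoris map `φ : H₀(Ũ ∩ Ṽ) → H₀(Ũ) ⊞ H₀(Ṽ)` is injective** when the
augmentation is injective on `H₀(N₊)` and `H₀(N₋)` (e.g. `N±` path connected or empty): writing a
class of `Ũ ∩ Ṽ` as `∑ₖ Eₖ(pₖ + qₖ)`, the vanishing of the two components gives
`ε pₖ + ε qₖ = 0` and `ε pₖ + ε qₖ₋₁ = 0`, so `ε q` is constant, hence zero by finiteness of the
support, and then everything vanishes. [folklore] -/
theorem φ_zero_injective (hεp : Injective (singularHomology.ε R M ↥D.plus))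
    (hεm : Injective (singularHomology.ε R M ↥D.minus)) :
    Injective (mayerVietoris.φ R M D.U D.V 0) := by
  classical
  rw [injective_iff_map_eq_zero]
  intro w hw
  obtain ⟨T, p, q, hp, hq, rfl⟩ := D.exists_eq_sum_plus_minus R M 0 w
  have h1 := congrArg (biprod.fst : singularHomology R M ↥D.U 0 ⊞ singularHomology R M ↥D.V 0 ⟶
    singularHomology R M ↥D.U 0) hw
  have h2 := congrArg (biprod.snd : singularHomology R M ↥D.U 0 ⊞ singularHomology R M ↥D.V 0 ⟶
    singularHomology R M ↥D.V 0) hw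
  rw [fst_φ_sum, map_zero] at h1
  rw [snd_φ_sum, map_zero, neg_eq_zero] at h2
  -- the two components
  have hY' : ∀ k, D.iPlus R M 0 (p k) + D.iMinus R M 0 (q k) = 0 := by
    have h1' : ∑ k ∈ T, singularHomology.map R M (sheetEmb D.hY k) 0 (D.iPlus R M 0 (p k) + D.iMinus R M 0 (q k)) =
        ∑ k ∈ T, singularHomology.map R M (sheetEmb D.hY k) 0 (0 : singularHomology R M ↥D.Y 0) := by
      rw [h1]; simp only [map_zero, Finset.sum_const_zero]
    exact D.eq_of_sum_Y_eq hp hq (fun _ _ => rfl) h1'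
  have hN' : ∀ k, D.jPlus R M 0 (p k) + D.jMinus R M 0 (q (k - 1)) = 0 :=
    D.eq_zero_of_sum_N_eq_zero hp hq h2
  -- augmentations
  have hεY : ∀ k, singularHomology.ε R M _ (p k) + singularHomology.ε R M _ (q k) = 0 := by
    intro k
    have := congrArg (singularHomology.ε R M ↥D.Y) (hY' k)
    rwa [map_add, map_zero, ε_map, ε_map] at this
  have hεN : ∀ k, singularHomology.ε R M _ (p k) + singularHomology.ε R M _ (q (k - 1)) = 0 := by
    intro k
    have := congrArg (singularHomology.ε R M ↥D.N) (hN' k)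
    rwa [map_add, map_zero, ε_map, ε_map] at this
  have hQ : ∀ k, singularHomology.ε R M _ (q k) = singularHomology.ε R M _ (q (k - 1)) := fun k => by
    have e : (singularHomology.ε R M _ (p k) + singularHomology.ε R M _ (q k)) -
        (singularHomology.ε R M _ (p k) + singularHomology.ε R M _ (q (k - 1))) = 0 := by
      rw [hεY k, hεN k, sub_zero]
    rwa [add_sub_add_left_eq_sub, sub_eq_zero] at e
  obtain ⟨k₁, hk₁⟩ := Infinite.exists_notMem_finset T
  have hq0 : ∀ k, singularHomology.ε R M _ (q k) = 0 :=
    eq_zero_of_forall_eq_pred hQ (by rw [hq k₁ hk₁, map_zero])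
  have hp0 : ∀ k, singularHomology.ε R M _ (p k) = 0 := fun k => by
    have := hεY k
    rwa [hq0 k, add_zero] at this
  have hpk : ∀ k, p k = 0 := fun k => hεp (by rw [hp0 k, map_zero])
  have hqk : ∀ k, q k = 0 := fun k => hεm (by rw [hq0 k, map_zero])
  exact Finset.sum_eq_zero fun k _ => by rw [hpk k, hqk k, map_zero, map_zero, add_zero, map_zero]

/-- Injectivity of the augmentation on `H₀` of a path-connected space. [folklore] -/
theorem ε_injective_of_pathConnectedSpace {P : Type u} [TopologicalSpace P] [PathConnectedSpace P] :
    Injective (singularHomology.ε R M P) := by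
  haveI := singularHomology.isIso_ε_of_pathConnectedSpace R M (X := P)
  exact (ModuleCat.mono_iff_injective _).mp inferInstance

/-- Injectivity of the augmentation on `H₀` of an empty space (the source is zero). [folklore] -/
theorem ε_injective_of_isEmpty {P : Type u} [TopologicalSpace P] [IsEmpty P] :
    Injective (singularHomology.ε R M P) := by
  intro a b _
  haveI : Subsingleton (singularHomology R M P 0) := by
    obtain ⟨a', rfl⟩ := (ModuleCat.epi_iff_surjective _).mp
      (inferInstance : Epi (csingularHomology.compIso R M P 0).hom) a
    haveI := ModuleCat.subsingleton_of_isZero (isZero_csingularHomology_of_isEmpty R M (X := P) 0)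
    exact ⟨fun u v => by
      obtain ⟨u', rfl⟩ := (ModuleCat.epi_iff_surjective _).mp
        (inferInstance : Epi (csingularHomology.compIso R M P 0).hom) u
      obtain ⟨v', rfl⟩ := (ModuleCat.epi_iff_surjective _).mp
        (inferInstance : Epi (csingularHomology.compIso R M P 0).hom) v
      rw [Subsingleton.elim u' v']⟩
  exact Subsingleton.elim a b

/-! ### Generation -/

variable (R M) in
/-- **The second Mayer–Vietoris map `ψ : H₁(Ũ) ⊞ H₁(Ṽ) → H₁(X̃)` is onto** when `φ` is injective
on `H₀` (the connecting map `H₁(X̃) → H₀(Ũ ∩ Ṽ)` then vanishes; exactness, Hatcher §2.2).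
[cite: HatcherAT2002, §2.2 pp. 149–150] -/
theorem ψ_one_surjective (hφ : Injective (mayerVietoris.φ R M D.U D.V 0)) :
    Surjective (mayerVietoris.ψ R M D.U D.V 1) := by
  intro x
  have hexact := mayerVietoris.exact₂_holds (R := R) (M := M) D.U D.V
    (relativeSingularHomology.isIso_map_of_interior_union_interior_holds R M (CyclicCover f))
    D.interior_U_union_interior_V 0
  have hδ : mayerVietoris.δ R M D.U D.V
      (relativeSingularHomology.isIso_map_of_interior_union_interior_holds R M (CyclicCover f))
      D.interior_U_union_interior_V 0 x = 0 := by
    apply hφ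
    rw [map_zero, ← ModuleCat.comp_apply, mayerVietoris.δ_comp_φ]
    rfl
  exact (ShortComplex.moduleCat_exact_iff _).1 hexact x hδ

variable (R M) in
/-- **The copies of `H₁(Y)` generate `H₁(X̃)`** (Rolfsen 1976, §8.C: "`H₁(X̃)` is generated by the
`tⁱ`-translates of generators of `H₁(Y)`"): if the augmentation is injective on `H₀(N₊)` and on
`H₀(N₋)` (e.g. both path connected) and `j₊ : H₁(N₊) → H₁(N)` is onto, every class of `H₁(X̃)` is
a finite sum `∑ₖ genₖ aₖ`. [cite: Rolfsen1976, §8.C] -/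
theorem exists_eq_sum_gen (hεp : Injective (singularHomology.ε R M ↥D.plus))
    (hεm : Injective (singularHomology.ε R M ↥D.minus)) (hj : Surjective (D.jPlus R M 1))
    (x : singularHomology R M (CyclicCover f) 1) :
    ∃ (S : Finset ℤ) (a : ℤ → singularHomology R M ↥D.Y 1), (∀ k ∉ S, a k = 0) ∧
      x = ∑ k ∈ S, D.gen R M k 1 (a k) := by
  classical
  obtain ⟨y, rfl⟩ := D.ψ_one_surjective R M (D.φ_zero_injective R M hεp hεm) x
  obtain ⟨S₁, a, hu⟩ := exists_eq_sum_map_sheetEmb D.hY R M 1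
    ((biprod.fst : singularHomology R M ↥D.U 1 ⊞ singularHomology R M ↥D.V 1 ⟶ singularHomology R M ↥D.U 1) y)
  obtain ⟨S₂, c, hv⟩ := exists_eq_sum_map_sheetEmb D.hN R M 1
    ((biprod.snd : singularHomology R M ↥D.U 1 ⊞ singularHomology R M ↥D.V 1 ⟶ singularHomology R M ↥D.V 1) y)
  -- lift the `N`-classes to `N₊`
  choose b hb using fun k => hj (c k)
  refine ⟨S₁ ∪ S₂, fun k => (if k ∈ S₁ then a k else 0) + (if k ∈ S₂ then D.iPlus R M 1 (b k) else 0),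
    fun k hk => ?_, ?_⟩
  · obtain ⟨hk1, hk2⟩ := Finset.notMem_union.1 hk
    simp only [if_neg hk1, if_neg hk2, add_zero]
  · have h₁ : ∑ k ∈ S₁ ∪ S₂, D.gen R M k 1 (if k ∈ S₁ then a k else 0) = ∑ k ∈ S₁, D.gen R M k 1 (a k) := by
      rw [← Finset.sum_subset Finset.subset_union_left]
      · exact Finset.sum_congr rfl fun k hk => by rw [if_pos hk]
      · intro k _ hk
        rw [if_neg hk, map_zero]
    have h₂ : ∑ k ∈ S₁ ∪ S₂, D.gen R M k 1 (if k ∈ S₂ then D.iPlus R M 1 (b k) else 0) =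
        ∑ k ∈ S₂, D.genN R M k 1 (c k) := by
      rw [← Finset.sum_subset Finset.subset_union_right]
      · exact Finset.sum_congr rfl fun k hk => by rw [if_pos hk, gen_iPlus, hb]
      · intro k _ hk
        rw [if_neg hk, map_zero]
    simp only [map_add, Finset.sum_add_distrib, h₁, h₂]
    rw [mayerVietoris.ψ, biprod_desc_apply, hu, hv, map_sum, map_sum]
    simp only [gen_apply, genN_apply]

/-! ### Completeness of the relations -/

variable (R M) in
/-- **The relations `genₖ (i₋ b) = genₖ₊₁ (i₊ b')` (`j₋ b = j₊ b'`) generate all relations among the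
copies of `H₁(Y)` in `H₁(X̃)`** (Rolfsen 1976, §8.C; exactness of Mayer–Vietoris at
`H₁(Ũ) ⊞ H₁(Ṽ)` and independence of the copies): if a finitely supported family `a` has
`∑ₖ genₖ aₖ = 0`, then `aₖ = i₋ bₖ − i₊ b'ₖ₋₁` for finitely supported families `b` in `H₁(N₋)`,
`b'` in `H₁(N₊)` with `j₋ bₖ = j₊ b'ₖ` for all `k` (no hypothesis on `j±` is needed here).
[cite: Rolfsen1976, §8.C] -/
theorem exists_rel_of_sum_gen_eq_zero (S : Finset ℤ)
    (a : ℤ → singularHomology R M ↥D.Y 1) (ha : ∀ k ∉ S, a k = 0)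
    (hsum : ∑ k ∈ S, D.gen R M k 1 (a k) = 0) :
    ∃ (T : Finset ℤ) (b : ℤ → singularHomology R M ↥D.minus 1) (b' : ℤ → singularHomology R M ↥D.plus 1),
      (∀ k ∉ T, b k = 0) ∧ (∀ k ∉ T, b' k = 0) ∧ (∀ k, D.jMinus R M 1 (b k) = D.jPlus R M 1 (b' k)) ∧
      ∀ k, a k = D.iMinus R M 1 (b k) - D.iPlus R M 1 (b' (k - 1)) := by
  classical
  -- the class `u = ∑ Eₖ aₖ` of `Ũ` with `ψ (u, 0) = 0`
  set u : singularHomology R M ↥D.U 1 := ∑ k ∈ S, singularHomology.map R M (sheetEmb D.hY k) 1 (a k) with hu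
  have hψ : mayerVietoris.ψ R M D.U D.V 1
      ((biprod.inl : singularHomology R M ↥D.U 1 ⟶ singularHomology R M ↥D.U 1 ⊞ singularHomology R M ↥D.V 1) u) = 0 := by
    rw [mayerVietoris.ψ, biprod_desc_inl_apply, hu, map_sum, ← hsum]
    simp only [gen_apply]
  have hexact := mayerVietoris.exact₁_holds (R := R) (M := M) D.U D.V D.interior_U_union_interior_V 1
  obtain ⟨w, hw⟩ := (ShortComplex.moduleCat_exact_iff _).1 hexact _ hψ
  obtain ⟨T, p, q, hp, hq, rfl⟩ := D.exists_eq_sum_plus_minus R M 1 w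
  have h1 := congrArg (biprod.fst : singularHomology R M ↥D.U 1 ⊞ singularHomology R M ↥D.V 1 ⟶
    singularHomology R M ↥D.U 1) hw
  have h2 := congrArg (biprod.snd : singularHomology R M ↥D.U 1 ⊞ singularHomology R M ↥D.V 1 ⟶
    singularHomology R M ↥D.V 1) hw
  rw [fst_φ_sum, ← ModuleCat.comp_apply, biprod.inl_fst, ModuleCat.id_apply, hu] at h1
  rw [snd_φ_sum, ← ModuleCat.comp_apply, biprod.inl_snd] at h2
  have h2' : ∑ k ∈ T, singularHomology.map R M (sheetEmb D.hN k) 1 (D.jPlus R M 1 (p k)) +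
      ∑ k ∈ T.map (addRightEmbedding 1),
        singularHomology.map R M (sheetEmb D.hN k) 1 (D.jMinus R M 1 (q (k - 1))) = 0 :=
    neg_eq_zero.1 (h2.trans rfl)
  have hY' : ∀ k, D.iPlus R M 1 (p k) + D.iMinus R M 1 (q k) = a k := D.eq_of_sum_Y_eq hp hq ha h1
  have hN' : ∀ k, D.jPlus R M 1 (p k) + D.jMinus R M 1 (q (k - 1)) = 0 := D.eq_zero_of_sum_N_eq_zero hp hq h2'
  -- `bₖ = qₖ`, `b'ₖ = -pₖ₊₁`
  refine ⟨T ∪ T.image (· - 1), q, fun k => -p (k + 1), fun k hk => hq k fun h' => hk (Finset.mem_union_left _ h'),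
    fun k hk => ?_, fun k => ?_, fun k => ?_⟩
  · dsimp only
    rw [hp (k + 1) fun h' => hk (Finset.mem_union_right _ (Finset.mem_image.2 ⟨k + 1, h', by simp⟩)),
      neg_zero]
  · dsimp only
    have e := hN' (k + 1)
    rw [add_sub_cancel_right] at e
    rw [map_neg, eq_neg_iff_add_eq_zero, add_comm, e]
  · dsimp only
    have e := hY' k
    rw [sub_add_cancel, map_neg, sub_neg_eq_add, add_comm, e]

end Homology




end CutData



end CyclicCover

end CircleMaps

end Literature.Topology.FourManifolds
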